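import Mathlib
import HarnessLib
import HarnessLib.Audit
import Summits.RiemannHypothesis.Statement
import HarnessLib.Audit.Status.Attr

/-!
Route: Strip

DORMANT since 2026-08-23T00:29:22Z (reconciler: no traction for 5.8 d (last activity item-evidence-added at 2026-08-17T04:55:41Z); parked, not closed — `ledger route dormant route-RiemannHypothesis-Strip --off` to reactivate) — unstaffed, not closed; items shared with open routes are served there. `ledger route dormant <id> --off` reactivates.

# Route Strip — the quasi-RH ladder: widen the zero-free region to a vertical strip, then to 1/2

**Thesis X (words).** For every `σ₀ > 1/2`, ζ has no zeros with `σ₀ < Re s < 1` (quasi-RH at every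
abscissa; Θ := sup Re ρ = 1/2).

Lean: `∀ σ₀ : ℝ, 1 / 2 < σ₀ → ∀ s : ℂ, riemannZeta s = 0 → σ₀ < s.re → s.re < 1 → False`

**X (Lean, gloss).** The line above is X = `StripThesis`, stated over Mathlib only; definitionally
`∀ σ₀ > 1/2, Literature.NumberTheory.LFunctions.QuasiRiemannHypothesis σ₀` (`Iff.rfl`). Since the
cone repair of 2026-08-15 (revs 3–6) EVERY item is stated over Mathlib alone
(`QuasiRiemannHypothesis` and `mertensFunction` unfolded definitionally, meaning unchanged), so the
route file imports nothing from `Literature/` and its dependency cone is Mathlib.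

**Deciding theorem (rev 2).** `closes : StripThesis → StripZeroFreeStrip → StripMertensPowerSaving →
StripBeatVinogradovKorobov → StripMertensDictionary → Summit.RiemannHypothesis`, proved from
`StripThesis` alone (a zero with `1/2 < Re s < 1` violates X at `σ₀ = (1/2 + Re s)/2`; one with `0 <
Re s < 1/2` gives the zero `1 − s` by Mathlib `riemannZeta_one_sub`; zeros with `Re s ≤ 0` are
trivial and `Re s ≥ 1` has none, `riemannZeta_ne_zero_of_one_le_re`) [Titchmarsh1986 §2.12]. The
`Assembly` item (rev 6) is restated as exactly the type of `closes` (the gate keeps an assembly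
item; a prover closes it by `exact closes`). The cruxes are RUNGS strictly below X (known ⊊ #5 ⊊ #2
⟺ #3 ⊊ X ⟺ RH): a ladder, not a decomposition — closing a crux is a milestone, not a proof of X.

Rationale: WHY THIS LINE. Everything unconditional about the zeros of ζ is a zero-free REGION shrinking to Re s
= 1 (de la Vallée Poussin 1899; Vinogradov–Korobov 1958, exponent 2/3, explicit in arXiv:2212.06867
= MossinghoffTrudgianYang2024) or a zero-DENSITY bound (Guth–Maynard 2024, arXiv:2405.20552). No
zero-free STRIP Re s > 1 − δ is known; any δ > 0 would be the biggest event in the subject since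
1896 and is the honest first rung of RH by this road (Ivic1985 §6.1; Titchmarsh1986 ch. 14). Two
outside toolkits get a typed entry point: (a) multiplicative/pretentious number theory — M(x) =
Σ_{n≤x} μ(n) ≪ x^θ for some θ < 1 is EQUIVALENT to a strip (Littlewood1912; Titchmarsh1986 Thm
14.25; EdwardsZeta1974 §12.1; both directions now proved in-tree:
quasiRiemannHypothesis_of_mertens_isBigO_holds, mertens_isBigO_of_quasiRiemannHypothesis_holds), and
Matomäki–Radziwiłł–Tao is the only new source of Möbius cancellation in 50 years
(MatomakiRadziwillAnnals2016; Koukoulopoulos arXiv:1203.0596); (b) exponential sums / decoupling —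
the VK exponent 2/3 comes from Vinogradov's mean value theorem, now optimal (Bourgain–Demeter–Guth,
Wooley), so 'exponent α < 2/3' isolates exactly what decoupling has NOT delivered (Heath-Brown
arXiv:1601.04493 p.2; Ford2002; BourgainJAMS2017). Imported areas: pretentious multiplicative NT for
#3, harmonic-analysis decoupling for #5, the analytic mainstream for #2.
RANKED CRUXES. #2 StripZeroFreeStrip (∃ δ > 0, no zero with 1 − δ < Re s < 1) — THE crux, open since
1896, RH-implied. #3 StripMertensPowerSaving (∃ θ < 1, M(x) = O(x^θ)) — ⟺ #2 in-tree via the support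
item StripMertensDictionary (= proved fact quasiRiemannHypothesis_of_mertens_isBigO, closes by one
`exact`) and the proved converse; the multiplicative entry point. #5 StripBeatVinogradovKorobov (∃ α
< 2/3, c > 0: ζ(σ+it) ≠ 0 for |t| ≥ 3, σ ≥ 1 − c/(log|t|)^α) — strictly between everything known and
#2; the exponential-sum entry point. Target #0 StripThesis = X; support #4 StripMertensDictionary
(provable now, one line). All items are Mathlib-only statements.
KILL CRITERIA. None of #2, #3, #5 can be refuted without refuting RH (all RH-implied), so the route
dies only by STARVATION: close `exhausted` if, once #4 is closed, refuter/grounder classify every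
crux 'no known method; equivalent to open folklore conjecture' AND no prover proposal or idea card
produces kernel-visible movement on #5/#3 within the tenure window set by the operator; or
`superseded` if another RH route absorbs #2 as its own crux with a mechanism. Documented no-go
results (Diamond–Montgomery–Vorhauer 2006 for Landau/Beurling-type arguments; limits of large-values
/ zero-detection methods for strips) are filed as barrier facts against #2, not as kills.
NOT DECOMPOSED YET. No Dirichlet-polynomial large-values items (Guth–Maynard machinery), no
Halász/pretentious lemmas, no explicit-constant versions, no split of #2; the Density Hypothesis is
deliberately NOT a crux (it is not on the implication chain to X). Depth only after a crux shows
traction (D-0019).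
CHEAPEST FALSIFIER. There is no cheap kill of X short of a zero off the line (Platt–Trudgian 2021:
none below height 3·10^12). The cheapest STRUCTURAL check has been run: every item elaborates over
Mathlib alone and `closes` is kernel-checked (axioms propext / Classical.choice / Quot.sound), so
the thesis literally decides RH; the cheapest check on the LINE is the refuter's novelty audit
(expected grade: known — reformulation ladder), which lowers staffing but does not close the route.

Novelty: Nearest prior art (searched 2026-08-14: lit search and lit search --hybrid 'quasi-Riemann hypothesis
zero-free strip', 'Vinogradov–Korobov exponent 2/3'; lit frontier and lit bridges RiemannHypothesis;
RH barrier catalogue): the thesis X (quasi-RH at every σ₀ > 1/2, i.e. Θ := sup Re ρ = 1/2) and its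
ladder are textbook — Titchmarsh1986 §14.25, Thm 14.25(C) (M(x) ≪ x^{1/2+ε} ⟺ RH), EdwardsZeta1974
§12.1 (M(x) = O(x^a) ⟹ 1/ζ analytic on Re s > a), MontgomeryVaughan2007 Thm 15.2 and (15.10)
(Θ-language, M(x) = Ω±(x^{Θ−ε})), Ivic1985 ch. 6 Thms 6.1–6.3 (VK region from the zeta-sum bound;
'all attempts to obtain σ > σ₀ … have failed'). Both 'entry points' exist in print as programmes:
pretentious (Koukoulopoulos arXiv:1203.0596 — VK strength only by importing the KV sums;
MatomakiRadziwillAnnals2016 — short-interval savings, no power) and decoupling, exponential sums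
(BourgainJAMS2017; Heath-Brown arXiv:1601.04493 — BDG 'not applicable' to the zero-free region;
Ford2002). Delta: NO new mechanism. The contribution is organisational: the first post-1958
improvements are typed as closable statements on one chain StripBeatVinogradovKorobov <
StripZeroFreeStrip ⟺ StripMertensPowerSaving < X ⟺ RH, with StripMertensDictionary provable now and
the Assembly discharged in evidence. Expected grade: known (reformulation ladder); at most 'variant'
for the milestone α < 2/3 without the loglog factor, not found as a named conjecture in the held
sources.  [refs: 1203.0596, 1601.04493, Titchmarsh1986, EdwardsZeta1974, MontgomeryVaughan2007, Ivic1985, MatomakiRadziwillAnnals2016, BourgainJAMS2017, Ford2002]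

Barriers (technique_class: zero-free-regions, Landau-method, decoupling, pretentious): technique_class: zero-free-regions, Landau-method, decoupling, pretentious
- Literature.Barriers.RiemannHypothesis.DiamondMontgomeryVorhauer2006_thm1: APPLIES to all three
cruxes — arguments using only multiplicativity + N(x) = x + O(x^θ) stop at σ > 1 − c/log t. Not
evaded, named: each crux must import ℤ-specific additive input; #5 names the known evasion (KV sums
Σ n^{−it}); #3's general pretentious part (Halász) is Beurling-compatible, capped at x loglog x/log
x (arXiv:1203.0596 p.4). The bet: new additive input.
- Literature.Barriers.RiemannHypothesis.DavenportHeilbronn: APPLIES to #2 (no strip from functional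
equation, mean values, AFE alone). Evaded in kind only: every crux is an Euler-product statement (μ
as ζ^{−1}; zeta-sums bounding log ζ near σ = 1); extending the product's 'sphere of influence'
(Titchmarsh1986 §3.1) to a strip IS #2.
- Literature.Barriers.RiemannHypothesis.BohrDenseValues: evaded — only non-vanishing is asserted;
StripMertensDictionary gives |1/ζ(s)| ≤ C|s|/(σ−θ), growing in |t|, no uniform bound.
- Literature.Barriers.RiemannHypothesis.LindelofBacklund: met by 'decoupling'. #5 lives at σ → 1
(t^{B(1−σ)^κ}, Ivic1985 Thm 6.3 + Landau's Thm 3.10), not LH at fixed σ > 1/2; moral ACCEPTED for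
#2: size bounds give o(log T) zeros per window or density, never emptiness; no claim #5 ⟹ #2.
- Literature.Barriers.RiemannHypothesis.MertensDisproof: not in class — #3 wants x^θ for SOME θ < 1,
not the ε-free √x bounds it refutes.
Other 15 RH entries: n/a.

Novelty grade: known — route-review+novelty (refuter 2026-08-15): KNOWN — reformulation ladder, no mechanism (planner's own expectation). X ⟺ RH is Titchmarsh §2.12 folklore, PROVED in-tree (Evidence.lean thesis_iff_riemannHypothesis); #3 ⟺ #2 is Littlewood 1912 / Titchmarsh Thm 14.25 / Edwards §12.1 p.256 ('if M(x) grows (refuter refuter-rreview1-RiemannHypothesis-Strip-91224359-0, 2026-08-15T18:18:24Z; prior: Titchmarsh1986 §14.25 Thm 14.25 (A)⟺(C), §14.32 p.280; §2.12, EdwardsZeta1974 §12.1 p.256 (M(x)=O(x^a) ⟹ 1/ζ analytic on Re s>a), MontgomeryVaughan2007 §15.1 (15.10), Thm 15.2, Ivic1985 §6.1, Thm 6.3, Thm 12.7, arXiv:2212.06867 MTY2024 Thm 1.1 (explicit VK, α=2/3), arXiv:1203.0596 Koukoulopoulos 2013, arXiv:1601.04493 Heath-Brown 2016 p.2, Littlewood1912,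 arXiv:2306.10680, 2301.03165, 2603.21490, )

History (route lifecycle, newest last):
- 2026-08-15T16:19:52Z · rev 3: restated StripThesis (stmt-RiemannHypothesis-0347) — cone repair (a): restate StripThesis by defeq unfolding of Literature QuasiRiemannHypothesis over Mathlib (meaning unchanged, Iff.rfl checked in Compat.lean rc0 (planner-rbadge-RiemannHypothesis-Strip-91224359-g2-0)
- 2026-08-15T16:20:46Z · rev 4: restated StripZeroFreeStrip (stmt-RiemannHypothesis-0349) — cone repair (a): restate StripZeroFreeStrip by defeq unfolding of QuasiRiemannHypothesis over Mathlib (meaning unchanged, Iff.rfl checked); removes the Generali (planner-rbadge-RiemannHypothesis-Strip-91224359-g2-0)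
- 2026-08-15T16:21:40Z · rev 5: restated StripMertensPowerSaving (stmt-RiemannHypothesis-0350) — cone repair (a): restate StripMertensPowerSaving by defeq unfolding of mertensFunction over Mathlib (meaning unchanged, Iff.rfl checked); removes the RHWave0 im (planner-rbadge-RiemannHypothesis-Strip-91224359-g2-0)
- 2026-08-15T16:23:25Z · rev 5: restated StripMertensDictionary (stmt-RiemannHypothesis-0351) — cone repair (a): restate StripMertensDictionary by defeq unfolding of mertensFunction/QuasiRiemannHypothesis over Mathlib (meaning unchanged, Iff.rfl + `example (planner-rbadge-RiemannHypothesis-Strip-91224359-g2-0)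
- 2026-08-15T16:32:19Z · rev 6: restated Assembly (stmt-RiemannHypothesis-0348) — cone repair (a) completed in one edit: restate Assembly Mathlib-only as the exact type of `closes` (gate: assembly cannot be dropped; it was the last statement (planner-rbadge-RiemannHypothesis-Strip-91224359-g2-0)
- 2026-08-16T04:16:35Z · AUTO-CRUX (backfill): StripThesis — hypotheses of the deciding theorem that nothing in the route derives are cruxes (operator:999:1085951)
- 2026-08-23T00:29:22Z · DORMANT — reconciler: no traction for 5.8 d (last activity item-evidence-added at 2026-08-17T04:55:41Z); parked, not closed — `ledger route dormant route-RiemannHypothesi (operator:999:2203410)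

sub-problem: RiemannHypothesis · status: dormant · opened planner-RiemannHypothesis-Survey-0 2026-08-13T06:10:39Z · rev 7 · ledger route-RiemannHypothesis-Strip
GENERATED by the gate from the ledger (D-0016/17). Provers cite these decls: `theorem foo : Summit.RiemannHypothesis.RiemannHypothesis.Theses.Strip.<Decl> := …` in Summits/RiemannHypothesis/RiemannHypothesis/Theorems/<Name>.lean.
-/

namespace Summit.RiemannHypothesis.RiemannHypothesis.Theses.Strip

open scoped BigOperators Topology Manifold Classical MeasureTheory ProbabilityTheory Matrix InnerProductSpace ComplexConjugate ContinuousMap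
open Filter Set Function TopologicalSpace MeasureTheory

attribute [summit_statement] _root_.Summit.RiemannHypothesis

open Summit

-- earlier StripThesis (stmt-RiemannHypothesis-0347, replaced 2026-08-15T16:19:52Z -> stmt-RiemannHypothesis-10635): retired by None — ∀ σ₀ : ℝ, 1 / 2 < σ₀ → Literature.NumberTheory.LFunctions.QuasiRiemannHypothesis σ₀
/-- item stmt-RiemannHypothesis-10635 · crux (kind.auto-crux: conjecture-grade) · rank 0 · open · by planner
why it might fail: X ⟺ RH: false iff some zero has Re ρ ≠ 1/2. As a plan it has no rung mechanism — nothing propagates a zero-free strip (rank 2) to smaller σ₀ (Ivić §6.1: every attempt at σ > σ₀, σ₀ < 1, has failed), so all cruxes can close with X untouched.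
sources: Titchmarsh1986 §2.12 p.26; §14.25 Thm 14.25(C) p.272, MontgomeryVaughan2007 Thm 15.2 p.354 (Θ = sup Re ρ), Ivic1985 §6.1 (PDF p.113)
Thesis X of route Strip: for every σ₀ > 1/2, riemannZeta has no zero with σ₀ < Re s < 1. This is
`Literature.NumberTheory.LFunctions.QuasiRiemannHypothesis σ₀` UNFOLDED over Mathlib (definitionally
equal, `Iff.rfl`), so that the route file imports nothing from Literature/ (cone repair 2026-08-15).
Equivalent to RH: the deciding theorem `closes` derives Summit.RiemannHypothesis from X alone (s ↦
1−s symmetry, Titchmarsh1986 §2.12); conversely RH ⟹ X trivially. The ladder makes a zero-free strip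
Re s > 1 − δ (crux #2) the first rung [Titchmarsh1986 ch. 14; IwaniecKowalski2004 §5]. -/
@[route_item "route-RiemannHypothesis-Strip", crux]
def StripThesis : Prop :=
  ∀ σ₀ : ℝ, 1 / 2 < σ₀ → ∀ s : ℂ, riemannZeta s = 0 → σ₀ < s.re → s.re < 1 → False

-- earlier StripZeroFreeStrip (stmt-RiemannHypothesis-0349, replaced 2026-08-15T16:20:46Z -> stmt-RiemannHypothesis-10660): retired by None — ∃ δ : ℝ, 0 < δ ∧ Literature.NumberTheory.LFunctions.QuasiRiemannHypothesis (1 - δ)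
/-- item stmt-RiemannHypothesis-10660 · crux · rank 2 · open · by planner
why it might fail: False iff Θ = sup Re ρ = 1; nothing excludes it. Known tools give widths → 0 (VK (log t)^{-2/3}(loglog t)^{-1/3}) or zero DENSITY (Guth–Maynard T^{30(1−σ)/13}), never emptiness; Landau/Beurling-type arguments provably stop at c/log t (DMV 2006); Euler-product-free ones fail (Davenport–Heilbronn).
sources: DiamondMontgomeryVorhauer2006 Thm 1 (barrier Literature.Barriers.RiemannHypothesis.DiamondMontgomeryVorhauer2006_thm1), arXiv:2212.06867 Thm 1.1 p.3 (MossinghoffTrudgianYang2024), arXiv:2405.20552 pp.3, 29 (GuthMaynard2024, density exponent 30/13), Titchmarsh1986 §10.25 (barrier Literature.Barriers.RiemannHypothesis.DavenportHeilbronn), §6.19 p.99, Ivic1985 Thm 6.1 and §6.1 (PDF p.113)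
THE crux: ζ(s) ≠ 0 for 1 − δ < Re s < 1 for some absolute δ > 0 — a zero-free VERTICAL STRIP (= `∃ δ
> 0, Literature.NumberTheory.LFunctions.QuasiRiemannHypothesis (1 − δ)` unfolded over Mathlib,
Iff.rfl; large δ is no loophole: δ > 1/2 is contradicted by critical-line zeros). Open since 1896;
known regions shrink to Re s = 1 like c/(log|t|)^{2/3}(log log|t|)^{1/3} (Vinogradov–Korobov 1958;
explicit MossinghoffTrudgianYang2024 Thm 1.1); density theorems (Guth–Maynard 2024) give few zeros,
never none. RH-implied. Equivalent to crux #3 (Möbius power saving) by the support item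
StripMertensDictionary (proved in Literature: quasiRiemannHypothesis_of_mertens_isBigO_holds) and
its converse (mertens_isBigO_of_quasiRiemannHypothesis_holds). Would give ψ(x) = x + O(x^{1−δ+ε}). -/
@[route_item "route-RiemannHypothesis-Strip", crux]
def StripZeroFreeStrip : Prop :=
  ∃ δ : ℝ, 0 < δ ∧ ∀ s : ℂ, riemannZeta s = 0 → 1 - δ < s.re → s.re < 1 → False

-- earlier StripMertensPowerSaving (stmt-RiemannHypothesis-0350, replaced 2026-08-15T16:21:40Z -> stmt-RiemannHypothesis-10714): retired by None — ∃ θ : ℝ, θ < 1 ∧ (fun x : ℝ => (Literature.NumberTheory.LFunctions.mertensFunction x : ℝ)) =O[Filter.atTop] fun x : ℝ => x ^ θ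
/-- item stmt-RiemannHypothesis-10714 · crux · rank 3 · open · by planner
why it might fail: False iff Θ = 1 (M(x) = Ω±(x^{Θ−ε}), MV (15.10)); ⟺ StripZeroFreeStrip. The pretentious entry is capped: Halász generality can never yield an error term better than x loglog x/log x and reaches VK strength only by importing the KV exponential sums (Koukoulopoulos 2013); MR/MRT save no power.
sources: MontgomeryVaughan2007 (15.10) p.356 and Thm 15.2 p.354, arXiv:1203.0596 pp.3–4 (Koukoulopoulos 2013), Ivic1985 Thm 12.7 p.231, MatomakiRadziwillAnnals2016; MatomakiRadziwillTao2015, Titchmarsh1986 Thm 14.25(C) p.272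
Multiplicative-functions entry point: M(x) = Σ_{n≤x} μ(n) = O(x^θ) for some θ < 1 — power
cancellation in Möbius. Here M(x) is written out as `∑ n ∈ Finset.Ioc 0 ⌊x⌋₊,
ArithmeticFunction.moebius n` (= `Literature.NumberTheory.LFunctions.mertensFunction x` unfolded
over Mathlib, Iff.rfl), so no Literature import. Known: M(x) ≪ x exp(−C (log x)^{3/5}(log log
x)^{−1/5}) (Walfisz 1963 from VK; Ivic1985 Thm 12.7); Matomäki–Radziwiłł(–Tao) give cancellation in
almost all short intervals but no power saving. RH ⟺ ∀ ε, M(x) ≪ x^{1/2+ε} [Littlewood1912;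
Titchmarsh1986 Thm 14.25(C)]. Equivalent to crux #2 via StripMertensDictionary and its converse
(both proved in Literature). Open. -/
@[route_item "route-RiemannHypothesis-Strip", crux]
def StripMertensPowerSaving : Prop :=
  ∃ θ : ℝ, θ < 1 ∧ (fun x : ℝ => ((∑ n ∈ Finset.Ioc 0 ⌊x⌋₊, ArithmeticFunction.moebius n : ℤ) : ℝ)) =O[Filter.atTop] fun x : ℝ => x ^ θ

/-- item stmt-RiemannHypothesis-0352 · crux · rank 5 · open · by planner
why it might fail: RH-implied (irrefutable short of ¬RH). α = 2/3 comes from the 3/2 in ζ(σ+it) ≪ t^{B(1−σ)^{3/2}}log^{2/3}t (Ivić Thm 6.3, Ford 2002) via Landau's Thm 3.10; α < 2/3 needs zeta-sum savings beyond N·exp(−c log³N/log²t), where the optimal VMVT (BDG) is 'not applicable' (Heath-Brown p.2); none since 1958.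
sources: Ivic1985 Thms 6.1–6.3 (PDF pp.113–114), Ford2002 Thm 1 (|ζ(σ+it)| ≤ 76.2 t^{4.45(1−σ)^{3/2}} log^{2/3} t), Heath-Brown 2016 = arXiv:1601.04493 p.2 ('crucial to have a suitable dependence on l, so that the new result of Bourgain, Demeter and Guth is not applicable'), Titchmarsh1986 Thm 3.10 (PDF p.44; Landau: ζ = O(e^φ) on σ ≥ 1−θ ⟹ no zeros in σ ≥ 1 − Aθ/φ); §6.19 p.99, MossinghoffTrudgianYang2024 = arXiv:2212.06867 Thm 1.1 (α = 2/3 with explicit constant, |t| ≥ 3), BourgainJAMS2017 (decoupling → ζ bounds); lean: Literature.NumberTheory.LFunctions.zero_free_region_vinogradov_korobov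
Exponential-sum entry point: ζ(σ+it) ≠ 0 for |t| ≥ 3 and σ ≥ 1 − c/(log|t|)^α with an exponent α <
2/3. Vinogradov–Korobov (1958) give α = 2/3 with an extra (log log|t|)^{1/3}
(Literature.NumberTheory.LFunctions.zero_free_region_vinogradov_korobov,
[MossinghoffTrudgianYang2024]); no improvement of the exponent in 65+ years. Strictly weaker than #2
(a strip is α = 0), strictly stronger than everything known; would follow from new bounds for Σ
n^{−it} beyond Vinogradov's mean value theorem (now sharp by decoupling, Bourgain–Demeter–Guth 2016)
— isolates what decoupling has not delivered. RH-implied. -/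
@[route_item "route-RiemannHypothesis-Strip", crux]
def StripBeatVinogradovKorobov : Prop :=
  ∃ α c : ℝ, α < 2 / 3 ∧ 0 < c ∧ ∀ σ t : ℝ, 3 ≤ |t| → 1 - c / Real.log |t| ^ α ≤ σ → riemannZeta (σ + t * Complex.I) ≠ 0

-- earlier StripMertensDictionary (stmt-RiemannHypothesis-0351, replaced 2026-08-15T16:23:25Z -> stmt-RiemannHypothesis-10766): retired by None — ∀ θ : ℝ, 0 < θ → θ < 1 → ((fun x : ℝ => (Literature.NumberTheory.LFunctions.mertensFunction x : ℝ)) =O[Filter.atTop] fun x : ℝ => x ^ θ) → Literature.NumberTheory.LFunctions.QuasiRiemannHypothesis θ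
/-- item stmt-RiemannHypothesis-10766 · support · rank 4 · open · by planner
sources: EdwardsZeta1974 §12.1 p.256, Titchmarsh1986 §14.25 p.272 (proof of Thm 14.25 (C)⟹RH, θ = 1/2 printed), MontgomeryVaughan2007 (15.10) p.356, Littlewood1912, lean fact: Literature.NumberTheory.LFunctions.quasiRiemannHypothesis_of_mertens_isBigO (Literature/NumberTheory/LFunctions/QuasiRHFacts.lean), Mathlib: LSeries_zeta_mul_Lseries_moebius, differentiableAt_riemannZeta, AnalyticOnNhd.eqOn_of_preconnected_of_eventuallyEq
The Mertens dictionary (support; the formal bridge crux #3 ⟹ crux #2): if M(x) = Σ_{n≤x} μ(n) ≪ x^θ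
with 0 < θ < 1 then ζ(s) ≠ 0 for θ < Re s < 1 — partial summation makes Σ μ(n) n^{−s} converge
locally uniformly on Re s > θ to a holomorphic G with G·ζ = 1 on Re s > 1 (Mathlib
LSeries_zeta_mul_Lseries_moebius), hence on Re s > θ by the identity theorem [Littlewood1912;
Titchmarsh1986 §14.25; EdwardsZeta1974 §12.1]. Written over Mathlib (mertensFunction and
QuasiRiemannHypothesis unfolded, Iff.rfl); it is VERBATIM the Literature fact
`Literature.NumberTheory.LFunctions.quasiRiemannHypothesis_of_mertens_isBigO`, PROVED in-tree as
`quasiRiemannHypothesis_of_mertens_isBigO_holds`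
(Literature/NumberTheory/LFunctions/LittlewoodCriterion.lean) — a prover closes this item by
`theorem … : Strip.StripMertensDictionary :=
Literature.NumberTheory.LFunctions.quasiRiemannHypothesis_of_mertens_isBigO_holds` (checked rc0 in
the planner folder, Compat.lean). -/
@[route_item "route-RiemannHypothesis-Strip", crux]
def StripMertensDictionary : Prop :=
  ∀ θ : ℝ, 0 < θ → θ < 1 → ((fun x : ℝ => ((∑ n ∈ Finset.Ioc 0 ⌊x⌋₊, ArithmeticFunction.moebius n : ℤ) : ℝ)) =O[Filter.atTop] fun x : ℝ => x ^ θ) → ∀ s : ℂ, riemannZeta s = 0 → θ < s.re → s.re < 1 → False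

-- earlier Assembly (stmt-RiemannHypothesis-0348, replaced 2026-08-15T16:32:19Z -> stmt-RiemannHypothesis-10930): retired by None — (∀ σ₀ : ℝ, 1 / 2 < σ₀ → Literature.NumberTheory.LFunctions.QuasiRiemannHypothesis σ₀) → Summit.RiemannHypothesis
/-- item stmt-RiemannHypothesis-10930 · assembly · rank 1 · open · by planner
Assembly = the type of the deciding theorem `closes` (rev 2): the listed items imply
Summit.RiemannHypothesis; in fact StripThesis (X) alone does — a zero with 1/2 < Re s < 1
contradicts X at σ₀ = (1/2 + Re s)/2, one with 0 < Re s < 1/2 gives the zero 1 − s (Mathlib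
riemannZeta_one_sub), Re s ≤ 0 zeros are trivial, Re s ≥ 1 has none [Titchmarsh1986 §2.12]. Stated
over the route decls only (no Literature constant), so the route imports Mathlib alone. A prover
closes this item by `theorem … : Strip.Assembly := Strip.closes`. -/
@[route_item "route-RiemannHypothesis-Strip"]
def Assembly : Prop :=
  StripThesis → StripZeroFreeStrip → StripMertensPowerSaving → StripBeatVinogradovKorobov → StripMertensDictionary → _root_.Summit.RiemannHypothesis

/-! D-0027 §2.1 — DECIDING THEOREM (planner-authored via `route open/edit --closes-file`; by planner-rbadge-RiemannHypothesis-Strip-91224359-g2-0 2026-08-15T16:18:41Z):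
its hypotheses are this route's items and its conclusion the sub-problem Statement (glue_lint), and it elaborates with this file. -/

/-- Deciding theorem of route Strip (D-0027 §2.1): the target `StripThesis` (quasi-RH at every
abscissa `σ₀ > 1/2`) implies `Summit.RiemannHypothesis` (= Mathlib's `RiemannHypothesis`).
A zero `s` with `1/2 < re s < 1` is excluded by X at `σ₀ = (1/2 + re s)/2`; a zero with
`0 < re s < 1/2` gives the zero `1 - s` with `1/2 < re (1-s) < 1` (functional equation, Mathlib
`riemannZeta_one_sub`); zeros with `re s ≤ 0` are the trivial ones and `re s ≥ 1` has none
(Mathlib `riemannZeta_ne_zero_of_one_le_re`). Mathlib-only proof (adapted from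
`Literature.NumberTheory.LFunctions.riemannZeta_eq_zero_iff_of_re_nonpos` /
`quasiRiemannHypothesis_one_half_iff_holds`, Titchmarsh 1986 §2.4, §2.12) so that the route file
imports nothing from `Literature/`. The cruxes are rungs strictly below X and are not used. -/
@[closes "route-RiemannHypothesis-Strip"] theorem closes (hX : StripThesis) (hStrip : StripZeroFreeStrip) (hMertens : StripMertensPowerSaving)
    (hVK : StripBeatVinogradovKorobov) (hDict : StripMertensDictionary) :
    _root_.Summit.RiemannHypothesis := by
  -- X at `σ₀ = (1/2 + re z)/2` excludes every zero `z` with `1/2 < re z < 1`.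
  have hQ : ∀ z : ℂ, riemannZeta z = 0 → 1 / 2 < z.re → z.re < 1 → False :=
    fun z hz h0 h1 => hX ((1 / 2 + z.re) / 2) (by linarith) z hz (by linarith) h1
  -- The zeros with `re s ≤ 0` are the trivial zeros `-2(n+1)` (functional equation
  -- `riemannZeta_one_sub`, non-vanishing on `re ≥ 1`, `Γ ≠ 0`, `cos (πt/2) = 0 ↔ t ∈ 2ℤ+1`).
  have htriv : ∀ s : ℂ, s.re ≤ 0 → riemannZeta s = 0 → ∃ n : ℕ, s = -2 * (n + 1) := by
    intro s hs h
    have hs0 : s ≠ 0 := by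
      rintro rfl
      rw [riemannZeta_zero] at h
      norm_num at h
    set t : ℂ := 1 - s with ht
    have hst : s = 1 - t := by simp [ht]
    have htre : 1 ≤ t.re := by simp [ht]; linarith
    have ht1 : t ≠ 1 := fun h1 => hs0 (by simp [hst, h1])
    have htn : ∀ n : ℕ, t ≠ -n := by
      intro n hn
      have := congrArg Complex.re hn
      simp at this
      linarith
    have hfe := riemannZeta_one_sub htn ht1
    rw [← hst, h] at hfe
    have hζt : riemannZeta t ≠ 0 := riemannZeta_ne_zero_of_one_le_re htre
    have hΓ : Complex.Gamma t ≠ 0 := Complex.Gamma_ne_zero_of_re_pos (by linarith)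
    have hπ : (Real.pi : ℂ) ≠ 0 := by exact_mod_cast Real.pi_ne_zero
    have hpow : (2 * (Real.pi : ℂ)) ^ (-t) ≠ 0 := by
      rw [Ne, Complex.cpow_eq_zero_iff, not_and_or]
      exact Or.inl (by simp [hπ])
    have hcos : Complex.cos (Real.pi * t / 2) = 0 := by
      have : 2 * (2 * (Real.pi : ℂ)) ^ (-t) * Complex.Gamma t * Complex.cos (Real.pi * t / 2) *
          riemannZeta t = 0 := hfe.symm
      simpa [hζt, hΓ, hpow] using this
    obtain ⟨k, hk⟩ := Complex.cos_eq_zero_iff.1 hcos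
    have htk : t = 2 * k + 1 := by
      have := mul_right_cancel₀ hπ
        (by linear_combination 2 * hk : t * Real.pi = (2 * k + 1) * Real.pi)
      simpa using this
    have hsk : s = -2 * k := by rw [hst, htk]; ring
    have hk0 : 0 ≤ k := by
      have := congrArg Complex.re hsk
      simp at this
      have : (k : ℝ) ≥ 0 := by linarith
      exact_mod_cast this
    have hk1 : k ≠ 0 := by
      rintro rfl
      exact hs0 (by simpa using hsk)
    obtain ⟨n, rfl⟩ : ∃ n : ℕ, k = n + 1 := ⟨(k - 1).toNat, by omega⟩
    exact ⟨n, by rw [hsk]; push_cast; ring⟩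
  -- Symmetry of the non-trivial zeros under `s ↦ 1 - s` (functional equation).
  have hsymm : ∀ s : ℂ, riemannZeta s = 0 → 0 < s.re → s.re < 1 → riemannZeta (1 - s) = 0 := by
    intro s hs h0 h1
    have hsn : ∀ n : ℕ, s ≠ -n := by
      intro n hn
      have := congrArg Complex.re hn
      simp at this
      linarith [n.cast_nonneg (α := ℝ)]
    have hs1 : s ≠ 1 := by
      rintro rfl
      simp at h1
    rw [riemannZeta_one_sub hsn hs1, hs, mul_zero]
  -- Mathlib's `RiemannHypothesis` (`Summit.RiemannHypothesis` unfolds to it).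
  intro s hs hnt _
  have h0 : 0 < s.re := by
    by_contra h0
    exact hnt (htriv s (not_lt.1 h0) hs)
  have h1 : s.re < 1 := by
    by_contra h1
    exact riemannZeta_ne_zero_of_one_le_re (not_lt.1 h1) hs
  rcases lt_trichotomy s.re (1 / 2) with hlt | heq | hgt
  · refine (hQ (1 - s) (hsymm s hs h0 h1) ?_ ?_).elim
    · simp only [Complex.sub_re, Complex.one_re]; linarith
    · simp only [Complex.sub_re, Complex.one_re]; linarith
  · exact heq
  · exact (hQ s hs hgt h1).elim

end Summit.RiemannHypothesis.RiemannHypothesis.Theses.Strip
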